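import Mathlib.Combinatorics.Hall.Basic
import Summits.ValiantsHypothesis.ValiantsHypothesis.Theorems.KPlusLogSqLawTropicalPageRigidity

/-!
# Route «KPlusLogSqLaw», cruxes `WeakLifting` / `TropicalB` — LEX TOP-CLASS RIGIDITY, perfect-matching form (three terms)

HONEST FRAMING.  Helper file (cell `pub-symmetroid`, seat val-sym-lift-p3 g4, 2026-08-27) toward the crux
`Summit.ValiantsHypothesis.ValiantsHypothesis.Theses.KPlusLogSqLaw.WeakLifting` (ledger item `stmt-ValiantsHypothesis-19561`; docket D2,
the `K = 4` tropical exponent fork).  It upgrades the three-term re-decomposition law of `…TropicalPageRigidity`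
(`classCount_eq_of_redecomp_three`) to single competitor terms.  A STRUCTURAL law for dominant terms of an arbitrary design in the lex
regime of one class; it proves no stub and asserts nothing about `TropicalB`, `WeakLifting`, `Lifting`, `KPlusLogSqLaw`, `MatrixDescartes`
(stmt-ValiantsHypothesis-18050) or `VP ≠ VNP`.

THE LAW (`classCount_eq_of_recombination_three`).  Let the class `l⋆` have exponent `≥ m·D`, `D` bounding every other exponent, and let
`t₀, t₁, t₂` be unique optima at slopes `θ₀ < θ₁ < θ₂` with the same number `c` of `l⋆`-entries.  Then EVERY term obtained by choosing in
each column one of the three entries of the `t`'s (rows bijective) again has exactly `c` entries of class `l⋆`.  In words: inside one page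
of a lex chain no competitor assembled from three page terms concentrates or dilutes the top class — the union of the three terms is
«rigid» for the top count.  (Consequence recorded in the seat's memo `K4-PAGE-RIGIDITY-AND-CARRIES.md`: for strongly lex designs the
union support of a page is GRADED for the top class.)

PROOF.  The entries not chosen form, column by column, two leftover entries whose rows cover every row exactly twice (each `t_r` is a
permutation and the chosen term uses every row once).  Hall's marriage theorem (Mathlib `Finset.all_card_le_biUnion_card_iff_exists_injective`;
the marriage condition is the double count «`2|S|` leftover slots over `S` land in rows absorbing `≤ 2` each») splits the leftovers into two
further terms, so the chosen term is one member of a columnwise re-decomposition of `(t₀, t₁, t₂)`, and `classCount_eq_of_redecomp_three`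
applies. [folklore: König / Hall for regular bipartite multigraphs; the packaging is the cell's]
-/

set_option linter.dupNamespace false
set_option autoImplicit false

namespace Summit.ValiantsHypothesis.ValiantsHypothesis.Theorems.LacunarySymmetroidMatrixDescartes.TropicalCensus

open Summit.ValiantsHypothesis.ValiantsHypothesis.Theorems.MatrixDescartes.Negative
open scoped BigOperators
open Finset

section PageRigidityMatching

variable {m K : ℕ}

/-- In `Fin 3`, away from two given elements there is a third. -/
theorem pageRigid_exists_third (a b : Fin 3) : ∃ r : Fin 3, r ≠ a ∧ r ≠ b := by
  revert a b; decide

/-- The row-incidence set of a row `a` in a family of three terms: the pairs (column, index) whose entry lies in row `a`;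
it has exactly three elements. -/
theorem pageRigid_card_incidence (t : Fin 3 → Equiv.Perm (Fin m) × (Fin m → Fin K)) (a : Fin m) :
    ((univ : Finset (Fin m × Fin 3)).filter fun p => (t p.2).1 p.1 = a).card = 3 := by
  classical
  -- bijection with `Fin 3`: r ↦ ((t r).1⁻¹ a, r)
  have h : ((univ : Finset (Fin m × Fin 3)).filter fun p => (t p.2).1 p.1 = a)
      = (univ : Finset (Fin 3)).image (fun r => (((t r).1).symm a, r)) := by
    ext p
    simp only [mem_filter, mem_univ, true_and, mem_image]
    constructor
    · intro hp
      refine ⟨p.2, ?_⟩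
      have : ((t p.2).1).symm a = p.1 := by rw [← hp]; simp
      rw [this]
    · rintro ⟨r, rfl⟩
      simp
  rw [h, card_image_of_injective _ (fun r r' hrr' => (Prod.mk.inj hrr').2)]
  simp

/-- **LEX TOP-CLASS RIGIDITY, perfect-matching form (three terms).**  If the exponent of the class `l⋆` is at least `m` times every
other exponent, and `t₀, t₁, t₂` are dominant at strictly increasing slopes with the same `l⋆`-count `c`, then every term obtained by
choosing in each column one of the three entries (with bijective rows) has `l⋆`-count `c`. [folklore] -/
theorem classCount_eq_of_recombination_three (d : Fin K → ℕ) (v ε : Fin m → Fin m → Fin K → ℤ)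
    (θ : Fin 3 → ℤ) (hθ : StrictMono θ) (t : Fin 3 → Equiv.Perm (Fin m) × (Fin m → Fin K))
    (hdom : ∀ r, IsDominant d v ε (θ r) (t r))
    (lstar : Fin K) (D : ℕ) (hD : ∀ l, l ≠ lstar → d l ≤ D) (hlex : m * D ≤ d lstar)
    (c : ℕ) (hc : ∀ r, (univ.filter fun i => (t r).2 i = lstar).card = c)
    (sel : Fin m → Fin 3) (hbij : Function.Bijective fun i => (t (sel i)).1 i) :
    (univ.filter fun i => (t (sel i)).2 i = lstar).card = c := by
  classical
  -- the chosen term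
  let σM : Equiv.Perm (Fin m) := Equiv.ofBijective _ hbij
  let M : Equiv.Perm (Fin m) × (Fin m → Fin K) := (σM, fun i => (t (sel i)).2 i)
  have hM1 : ∀ i, M.1 i = (t (sel i)).1 i := fun i => rfl
  -- leftover candidate rows per column
  let L : Fin m → Finset (Fin m) := fun i => ((univ : Finset (Fin 3)).filter (· ≠ sel i)).image fun r => (t r).1 i
  -- Hall's condition by double counting
  have hHall : ∀ s : Finset (Fin m), s.card ≤ (s.biUnion L).card := by
    intro s
    let P : Finset (Fin m × Fin 3) := (s ×ˢ (univ : Finset (Fin 3))).filter fun p => ¬ (p.2 = sel p.1)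
    let g : Fin m × Fin 3 → Fin m := fun p => (t p.2).1 p.1
    -- |P| = 2|s|
    have hPcard : P.card = 2 * s.card := by
      have hsplit := Finset.card_filter_add_card_filter_not (s := s ×ˢ (univ : Finset (Fin 3)))
        (fun p : Fin m × Fin 3 => p.2 = sel p.1)
      have hPc : P.card = ((s ×ˢ (univ : Finset (Fin 3))).filter fun p : Fin m × Fin 3 => ¬ (p.2 = sel p.1)).card := rfl
      have hgraph : ((s ×ˢ (univ : Finset (Fin 3))).filter fun p : Fin m × Fin 3 => p.2 = sel p.1)
          = s.image fun i => (i, sel i) := by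
        ext p
        simp only [mem_filter, mem_product, mem_univ, and_true, mem_image]
        constructor
        · rintro ⟨h1, h2⟩; exact ⟨p.1, h1, by rw [← h2]⟩
        · rintro ⟨i, hi, rfl⟩; exact ⟨hi, rfl⟩
      have hgc : (s.image fun i => (i, sel i)).card = s.card :=
        card_image_of_injective _ fun i j hij => (Prod.mk.inj hij).1
      rw [hgraph, hgc, card_product, card_univ, Fintype.card_fin] at hsplit
      omega
    -- image of P under g lies in the union
    have himg : P.image g ⊆ s.biUnion L := by
      intro a ha
      rw [mem_image] at ha
      obtain ⟨p, hp, rfl⟩ := ha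
      simp only [P, mem_filter, mem_product, mem_univ, and_true] at hp
      rw [mem_biUnion]
      exact ⟨p.1, hp.1, mem_image.mpr ⟨p.2, mem_filter.mpr ⟨mem_univ _, hp.2⟩, rfl⟩⟩
    -- every row absorbs at most two leftover slots
    have hfib : ∀ a ∈ P.image g, (P.filter fun p => g p = a).card ≤ 2 := by
      intro a _
      -- the chosen term's incidence at row `a`
      let ia : Fin m := σM.symm a
      have hia : (t (sel ia)).1 ia = a := σM.apply_symm_apply a
      have hsub : (P.filter fun p => g p = a) ⊆
          (((univ : Finset (Fin m × Fin 3)).filter fun p => (t p.2).1 p.1 = a).erase (ia, sel ia)) := by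
        intro p hp
        simp only [mem_filter, P, mem_product, mem_univ, and_true, g] at hp
        rw [mem_erase, mem_filter]
        refine ⟨?_, mem_univ _, hp.2⟩
        intro hpe
        rw [hpe] at hp
        exact hp.1.2 rfl
      calc (P.filter fun p => g p = a).card
          ≤ (((univ : Finset (Fin m × Fin 3)).filter fun p => (t p.2).1 p.1 = a).erase (ia, sel ia)).card :=
            card_le_card hsub
        _ = 2 := by
            have hmem : (ia, sel ia) ∈ ((univ : Finset (Fin m × Fin 3)).filter fun p => (t p.2).1 p.1 = a) :=
              mem_filter.mpr ⟨mem_univ _, hia⟩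
            rw [card_erase_of_mem hmem, pageRigid_card_incidence]
    have hle := card_le_mul_card_image P 2 hfib
    have := card_le_card himg
    omega
  -- Hall: an injective choice of leftover rows
  obtain ⟨f, hfinj, hfmem⟩ := (all_card_le_biUnion_card_iff_exists_injective L).mp hHall
  have hr₁ : ∀ i, ∃ r, r ≠ sel i ∧ (t r).1 i = f i := by
    intro i
    have := hfmem i
    simp only [L, mem_image, mem_filter, mem_univ, true_and] at this
    obtain ⟨r, hr, hr'⟩ := this
    exact ⟨r, hr, hr'⟩
  choose r₁ hr₁ne hr₁row using hr₁
  have hr₂ : ∀ i, ∃ r, r ≠ sel i ∧ r ≠ r₁ i := fun i => pageRigid_exists_third _ _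
  choose r₂ hr₂sel hr₂one using hr₂
  -- the second term
  have hfbij : Function.Bijective f := Finite.injective_iff_bijective.mp hfinj
  let u₁ : Equiv.Perm (Fin m) × (Fin m → Fin K) := (Equiv.ofBijective f hfbij, fun i => (t (r₁ i)).2 i)
  -- the third term: rows are injective by counting incidences at a row
  let g₂ : Fin m → Fin m := fun i => (t (r₂ i)).1 i
  have hg₂inj : Function.Injective g₂ := by
    intro i j hij
    by_contra hne
    -- four distinct incidences at the row a := g₂ i
    obtain ⟨i₁, hi₁⟩ := hfbij.2 (g₂ i)
    have hia : (t (sel (σM.symm (g₂ i)))).1 (σM.symm (g₂ i)) = g₂ i := σM.apply_symm_apply (g₂ i)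
    have hS : ({(σM.symm (g₂ i), sel (σM.symm (g₂ i))), (i₁, r₁ i₁), (i, r₂ i), (j, r₂ j)} : Finset (Fin m × Fin 3)) ⊆
        ((univ : Finset (Fin m × Fin 3)).filter fun p => (t p.2).1 p.1 = g₂ i) := by
      intro p hp
      simp only [mem_insert, mem_singleton] at hp
      rw [mem_filter]
      refine ⟨mem_univ _, ?_⟩
      rcases hp with h | h | h | h
      · rw [h]; exact hia
      · rw [h]; show (t (r₁ i₁)).1 i₁ = g₂ i
        rw [hr₁row]; exact hi₁
      · rw [h]
      · rw [h]; exact hij.symm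
    have hcard4 : ({(σM.symm (g₂ i), sel (σM.symm (g₂ i))), (i₁, r₁ i₁), (i, r₂ i), (j, r₂ j)} :
        Finset (Fin m × Fin 3)).card = 4 := by
      have h12 : (σM.symm (g₂ i), sel (σM.symm (g₂ i))) ≠ (i₁, r₁ i₁) := by
        intro h; have h1 := (Prod.mk.inj h).1; have h2 := (Prod.mk.inj h).2
        rw [h1] at h2; exact hr₁ne _ h2.symm
      have h13 : (σM.symm (g₂ i), sel (σM.symm (g₂ i))) ≠ (i, r₂ i) := by
        intro h; have h1 := (Prod.mk.inj h).1; have h2 := (Prod.mk.inj h).2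
        rw [h1] at h2; exact hr₂sel _ h2.symm
      have h14 : (σM.symm (g₂ i), sel (σM.symm (g₂ i))) ≠ (j, r₂ j) := by
        intro h; have h1 := (Prod.mk.inj h).1; have h2 := (Prod.mk.inj h).2
        rw [h1] at h2; exact hr₂sel _ h2.symm
      have h23 : (i₁, r₁ i₁) ≠ (i, r₂ i) := by
        intro h; have h1 := (Prod.mk.inj h).1; have h2 := (Prod.mk.inj h).2
        rw [h1] at h2; exact hr₂one _ h2.symm
      have h24 : (i₁, r₁ i₁) ≠ (j, r₂ j) := by
        intro h; have h1 := (Prod.mk.inj h).1; have h2 := (Prod.mk.inj h).2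
        rw [h1] at h2; exact hr₂one _ h2.symm
      have h34 : (i, r₂ i) ≠ (j, r₂ j) := by
        intro h; exact hne (Prod.mk.inj h).1
      rw [card_insert_of_notMem, card_insert_of_notMem, card_insert_of_notMem, card_singleton]
      · simp only [mem_singleton]; exact h34
      · simp only [mem_insert, mem_singleton, not_or]; exact ⟨h23, h24⟩
      · simp only [mem_insert, mem_singleton, not_or]; exact ⟨h12, h13, h14⟩
    have := card_le_card hS
    rw [hcard4, pageRigid_card_incidence] at this
    omega
  have hg₂bij : Function.Bijective g₂ := Finite.injective_iff_bijective.mp hg₂inj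
  let u₂ : Equiv.Perm (Fin m) × (Fin m → Fin K) := (Equiv.ofBijective g₂ hg₂bij, fun i => (t (r₂ i)).2 i)
  -- the re-decomposition
  let U : Fin 3 → Equiv.Perm (Fin m) × (Fin m → Fin K) := ![M, u₁, u₂]
  -- per-column index permutation
  have hcol : ∀ i : Fin m, (univ : Finset (Fin 3)).val.map (fun r => ((U r).1 i, (U r).2 i)) =
      (univ : Finset (Fin 3)).val.map (fun r => ((t r).1 i, (t r).2 i)) := by
    intro i
    let e : Fin 3 → Fin 3 := ![sel i, r₁ i, r₂ i]
    have heinj : Function.Injective e := by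
      intro a b hab
      fin_cases a <;> fin_cases b <;> simp [e] at hab ⊢ <;> first
        | exact absurd hab.symm (hr₁ne i) | exact absurd hab.symm (hr₂sel i) | exact absurd hab (hr₁ne i)
        | exact absurd hab.symm (hr₂one i) | exact absurd hab (hr₂sel i) | exact absurd hab (hr₂one i)
    let π : Equiv.Perm (Fin 3) := Equiv.ofBijective e (Finite.injective_iff_bijective.mp heinj)
    have hU : ∀ r, ((U r).1 i, (U r).2 i) = ((t (π r)).1 i, (t (π r)).2 i) := by
      intro r
      fin_cases r
      · exact Prod.ext rfl rfl
      · exact Prod.ext (hr₁row i).symm rfl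
      · exact Prod.ext rfl rfl
    calc (univ : Finset (Fin 3)).val.map (fun r => ((U r).1 i, (U r).2 i))
        = (univ : Finset (Fin 3)).val.map (fun r => ((t (π r)).1 i, (t (π r)).2 i)) := by
          congr 1; funext r; exact hU r
      _ = (univ : Finset (Fin 3)).val.map (fun r => ((t r).1 i, (t r).2 i)) := pageRigid_colMultiset_comp_equiv t π i
  have hall := classCount_eq_of_redecomp_three d v ε θ hθ t U hdom hcol lstar D hD hlex c hc 0
  simpa [U] using hall

end PageRigidityMatching

end Summit.ValiantsHypothesis.ValiantsHypothesis.Theorems.LacunarySymmetroidMatrixDescartes.TropicalCensus
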